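import Summits.AtomisticToContinuum.HydrodynamicLimit.Theorems.OneFlightGossipEngineKineticCurrentsWindowLDUniformOneBodyLedgerPrelimA
import HarnessLib

/-!
# One-body entropy ledger — preliminaries B: the kinetic pairing is paid by the root entropy
# (helper file of stub `stub_oneBodyLedger_of_static`, line `local-gibbs-entropy-ledger`,
# crux `KineticCurrentsWindowLDUniform`, stmt-AtomisticToContinuum-14662)

The registered helper stub `stub_oneBodyLedger_of_static_kinetic` (end of file): for `C ≥ 0`,
`Θ ≥ 1` there is `L = L(C,Θ) > 0` such that for every continuous `g` with `|g| ≤ C(1 + ‖v‖²)`,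
every cold Maxwellian `N = N(u, θ id)` (`0 < θ ≤ Θ`, `‖u‖² ≤ Θ`) and every probability `μ` on `ℝ³`
with `∫ ‖v‖² dμ ≤ Θ` and `H = KL(μ ‖ N) < ∞`: `|∫ g dμ - ∫ g dN| ≤ L √H`.

Proof (Donsker–Varadhan with a sub-exponential moment, NOT Pinsker):
* `obl_dv_scale` — for probability measures `μ, ν`, `KL(μ‖ν) < ∞`, and an exponential moment
  `∫ e^{2s₀|g - E_ν g|} dν ≤ J`: `s |∫ g dμ - ∫ g dν| ≤ KL(μ‖ν) + s² (2J/s₀²)` for `0 < s ≤ s₀`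
  (the easy half `∫ φ dμ ≤ KL + ∫ (e^φ - 1) dν` of `Literature.Probability.Divergences.FDivVariational`
  at `φ = ±s(g - E_ν g)`, whose `ν`-mean vanishes, and the remainder bound
  `e^q - 1 - q ≤ q² e^{|q|}`, `obl_exp_sub_one_sub_le`, at scale `s ≤ s₀`, `obl_exp_remainder_le`);
* the exponential moment is uniform over cold Maxwellians by a Fernique constant of the standard
  Gaussian (`obl_integrable_exp_sq_gaussMeasure` of Prelim A) once `s₀ = c/(4(A+1)Θ)`,
  `A = C(2 + 8Θ)` (`obl_scale`);
* optimisation in `s` (`obl_optimize`): `s = √(H/κ)` when admissible gives `2√(κH)`, otherwise the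
  crude second-moment bound `|∫ g dμ - E_N g| ≤ C(2 + 9Θ)` is already `≤ const · √H`; `H = 0` forces
  `μ = N` (converse Gibbs inequality).
Folklore throughout; constants explicit but not optimised.
-/

noncomputable section

open MeasureTheory Set Filter InformationTheory ProbabilityTheory
open scoped ENNReal Topology

namespace Summit.AtomisticToContinuum.HydrodynamicLimit.Theorems.KineticCurrentsWindowLDUniformLocalGibbs

open Literature.Analysis.FluidPDE (localMaxwellian)
open Literature.MathematicalPhysics.KineticTheory (T3 V3 gaussMeasure localMaxwellian_pos
  localMaxwellian_nonneg continuous_localMaxwellian integral_localMaxwellian_smul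
  withDensity_localMaxwellian_eq_gaussMeasure integral_gaussMeasure integral_norm_sq_stdGaussian
  integrable_norm_sq_stdGaussian)

/-! ### Elementary inequalities -/

/-- `e^q - 1 - q ≤ q² e^{|q|}` for every real `q` (from `1 + x ≤ eˣ` only). [folklore] -/
theorem obl_exp_sub_one_sub_le (q : ℝ) : Real.exp q - 1 - q ≤ q ^ 2 * Real.exp |q| := by
  have h1 : q + 1 ≤ Real.exp q := Real.add_one_le_exp q
  have h2 : -q + 1 ≤ Real.exp (-q) := Real.add_one_le_exp (-q)
  have hpos : 0 < Real.exp q := Real.exp_pos q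
  have hprod : Real.exp q * Real.exp (-q) = 1 := by
    rw [← Real.exp_add, add_neg_cancel, Real.exp_zero]
  have h3 : Real.exp q * (1 - q) ≤ 1 := by
    calc Real.exp q * (1 - q) ≤ Real.exp q * Real.exp (-q) :=
          mul_le_mul_of_nonneg_left (by linarith) hpos.le
      _ = 1 := hprod
  have h4 : Real.exp q - 1 ≤ q * Real.exp q := by nlinarith
  rcases le_total 0 q with hq | hq
  · rw [abs_of_nonneg hq]
    have h5 : q * (Real.exp q - 1) ≤ q * (q * Real.exp q) := mul_le_mul_of_nonneg_left h4 hq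
    nlinarith
  · rw [abs_of_nonpos hq]
    have h5 : 1 - Real.exp q ≤ -q := by linarith
    have h6 : (-q) * (1 - Real.exp q) ≤ (-q) * (-q) := mul_le_mul_of_nonneg_left h5 (by linarith)
    have h7 : 1 ≤ Real.exp (-q) := by linarith
    have h8 : q ^ 2 ≤ q ^ 2 * Real.exp (-q) := le_mul_of_one_le_right (sq_nonneg q) h7
    nlinarith

/-- The exponential remainder at scale `s ≤ s₀`: `e^{sy} - 1 - sy ≤ (2s²/s₀²) e^{2 s₀ |y|}`
(`q² e^{|q|}` with `q = sy`, `y² ≤ (2/s₀²) e^{s₀|y|}`). [folklore] -/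
theorem obl_exp_remainder_le {s s₀ : ℝ} (hs : 0 ≤ s) (hss : s ≤ s₀) (hs₀ : 0 < s₀) (y : ℝ) :
    Real.exp (s * y) - 1 - s * y ≤ 2 * s ^ 2 / s₀ ^ 2 * Real.exp (2 * s₀ * |y|) := by
  have h1 := obl_exp_sub_one_sub_le (s * y)
  rw [abs_mul, abs_of_nonneg hs, mul_pow, ← sq_abs y] at h1
  have hy : 0 ≤ |y| := abs_nonneg y
  have h2 : Real.exp (s * |y|) ≤ Real.exp (s₀ * |y|) :=
    Real.exp_le_exp.2 (mul_le_mul_of_nonneg_right hss hy)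
  have h3 : (s₀ * |y|) ^ 2 / 2 ≤ Real.exp (s₀ * |y|) := by
    have := Real.quadratic_le_exp_of_nonneg (mul_nonneg hs₀.le hy)
    nlinarith [mul_nonneg hs₀.le hy]
  have h4 : Real.exp (2 * s₀ * |y|) = Real.exp (s₀ * |y|) * Real.exp (s₀ * |y|) := by
    rw [← Real.exp_add]; ring_nf
  have h5 : |y| ^ 2 ≤ 2 / s₀ ^ 2 * Real.exp (s₀ * |y|) := by
    rw [div_mul_eq_mul_div, le_div_iff₀ (by positivity)]
    nlinarith
  rw [h4]
  calc Real.exp (s * y) - 1 - s * y ≤ s ^ 2 * |y| ^ 2 * Real.exp (s * |y|) := h1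
    _ ≤ s ^ 2 * (2 / s₀ ^ 2 * Real.exp (s₀ * |y|)) * Real.exp (s₀ * |y|) := by gcongr
    _ = 2 * s ^ 2 / s₀ ^ 2 * (Real.exp (s₀ * |y|) * Real.exp (s₀ * |y|)) := by ring

/-- **Optimising the Donsker–Varadhan scale.** If `s D ≤ a² + s² b²` for all `0 < s ≤ s₀` and
`0 ≤ D ≤ D₀` (`a, b, s₀ > 0`), then `D ≤ (2b + D₀/(s₀ b)) a`: take `s = a/b` when admissible,
otherwise `a > s₀ b` and the crude bound `D₀` is already linear in `a`. [folklore] -/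
theorem obl_optimize {D D₀ a b s₀ : ℝ} (hD : 0 ≤ D) (hDD : D ≤ D₀) (ha : 0 < a) (hb : 0 < b)
    (hs₀ : 0 < s₀) (key : ∀ s : ℝ, 0 < s → s ≤ s₀ → s * D ≤ a ^ 2 + s ^ 2 * b ^ 2) :
    D ≤ (2 * b + D₀ / (s₀ * b)) * a := by
  have h0 : 0 ≤ D₀ := hD.trans hDD
  have hq : 0 ≤ D₀ / (s₀ * b) := by positivity
  by_cases hcase : a ≤ s₀ * b
  · have hk := key (a / b) (by positivity) (by rwa [div_le_iff₀ hb])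
    have e : (a / b) ^ 2 * b ^ 2 = a ^ 2 := by field_simp
    rw [e, div_mul_eq_mul_div, div_le_iff₀ hb] at hk
    have hk' : D ≤ 2 * b * a := by nlinarith
    nlinarith
  · push Not at hcase
    calc D ≤ D₀ := hDD
      _ = D₀ / (s₀ * b) * (s₀ * b) := by field_simp
      _ ≤ D₀ / (s₀ * b) * a := mul_le_mul_of_nonneg_left hcase.le hq
      _ ≤ (2 * b + D₀ / (s₀ * b)) * a := by nlinarith

/-! ### Gaussian moments and quadratic-growth observables -/

/-- Second moment of `gaussMeasure u θ`: `‖v‖²` is integrable and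
`∫ ‖v‖² dN(u,θ) ≤ 2‖u‖² + 6θ`. [folklore] -/
theorem obl_norm_sq_gaussMeasure (u : V3) {θ : ℝ} (hθ : 0 < θ) :
    Integrable (fun v : V3 => ‖v‖ ^ 2) (gaussMeasure u θ) ∧
      ∫ v, ‖v‖ ^ 2 ∂gaussMeasure u θ ≤ 2 * ‖u‖ ^ 2 + 6 * θ := by
  have hdom : Integrable (fun w : V3 => 2 * ‖u‖ ^ 2 + 2 * θ * ‖w‖ ^ 2) (stdGaussian V3) :=
    (integrable_const _).add (integrable_norm_sq_stdGaussian.const_mul _)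
  have hint' : Integrable (fun w : V3 => ‖u + Real.sqrt θ • w‖ ^ 2) (stdGaussian V3) :=
    hdom.mono' (by fun_prop : Continuous fun w : V3 => ‖u + Real.sqrt θ • w‖ ^ 2).aestronglyMeasurable
      (ae_of_all _ fun w => by
        rw [Real.norm_eq_abs, abs_of_nonneg (sq_nonneg _)]
        exact EnergyCurrentTailsLevelCensus.norm_add_sqrt_smul_sq_le u w hθ.le)
  constructor
  · rw [gaussMeasure]
    exact (integrable_map_measure
      (by fun_prop : Continuous fun v : V3 => ‖v‖ ^ 2).aestronglyMeasurable (by fun_prop)).2 hint'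
  · rw [integral_gaussMeasure u hθ]
    calc ∫ w, ‖u + Real.sqrt θ • w‖ ^ 2 ∂stdGaussian V3
        ≤ ∫ w, (2 * ‖u‖ ^ 2 + 2 * θ * ‖w‖ ^ 2) ∂stdGaussian V3 :=
          integral_mono hint' hdom fun w => EnergyCurrentTailsLevelCensus.norm_add_sqrt_smul_sq_le u w hθ.le
      _ = 2 * ‖u‖ ^ 2 + 6 * θ := by
          rw [integral_add (integrable_const _) (integrable_norm_sq_stdGaussian.const_mul _),
            integral_const, probReal_univ, one_smul, integral_const_mul, integral_norm_sq_stdGaussian,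
            Fintype.card_fin]
          push_cast
          ring

/-- A continuous observable of quadratic growth `|g| ≤ C(1 + ‖v‖²)` is integrable under a
probability measure with finite second moment, and `|∫ g dμ| ≤ C (1 + ∫ ‖v‖² dμ)`. [folklore] -/
theorem obl_integrable_of_growth {μ : Measure V3} [IsProbabilityMeasure μ]
    (h2 : Integrable (fun v : V3 => ‖v‖ ^ 2) μ) {g : V3 → ℝ} (hg : Continuous g) {C : ℝ}
    (hC : ∀ v, |g v| ≤ C * (1 + ‖v‖ ^ 2)) :
    Integrable g μ ∧ |∫ v, g v ∂μ| ≤ C * (1 + ∫ v, ‖v‖ ^ 2 ∂μ) := by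
  have hdom : Integrable (fun v : V3 => C * (1 + ‖v‖ ^ 2)) μ :=
    ((integrable_const _).add h2).const_mul C
  have hgi : Integrable g μ :=
    hdom.mono' hg.aestronglyMeasurable (ae_of_all _ fun v => by rw [Real.norm_eq_abs]; exact hC v)
  refine ⟨hgi, ?_⟩
  calc |∫ v, g v ∂μ| ≤ ∫ v, |g v| ∂μ := abs_integral_le_integral_abs
    _ ≤ ∫ v, C * (1 + ‖v‖ ^ 2) ∂μ := integral_mono hgi.abs hdom hC
    _ = C * (1 + ∫ v, ‖v‖ ^ 2 ∂μ) := by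
        rw [integral_const_mul, integral_add (integrable_const _) h2, integral_const, probReal_univ,
          one_smul]

/-! ### The kinetic pairing bound -/

/-- Choice of the Donsker–Varadhan scale: `s₀ = c/(4(A+1)Θ)` satisfies `2 s₀ A ≤ c` and
`4 s₀ A Θ ≤ c` (`c > 0`, `A ≥ 0`, `Θ ≥ 1`). [folklore] -/
theorem obl_scale (c A Θ : ℝ) (hc : 0 < c) (hA : 0 ≤ A) (hΘ : 1 ≤ Θ) :
    ∃ s₀ : ℝ, 0 < s₀ ∧ 2 * s₀ * A ≤ c ∧ 4 * s₀ * A * Θ ≤ c := by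
  have hΘ0 : 0 < Θ := by linarith
  refine ⟨c / (4 * (A + 1) * Θ), by positivity, ?_, ?_⟩
  · have e : 2 * (c / (4 * (A + 1) * Θ)) * A = c * (2 * A) / (4 * (A + 1) * Θ) := by ring
    rw [e, div_le_iff₀ (by positivity)]
    exact mul_le_mul_of_nonneg_left (by nlinarith) hc.le
  · have e : 4 * (c / (4 * (A + 1) * Θ)) * A * Θ = c * (4 * A * Θ) / (4 * (A + 1) * Θ) := by ring
    rw [e, div_le_iff₀ (by positivity)]
    exact mul_le_mul_of_nonneg_left (by nlinarith) hc.le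

/-- **Donsker–Varadhan at scale `s`.** For probability measures `μ, ν` with `KL(μ‖ν) < ∞`, a
measurable `g` integrable under both, and an exponential moment
`∫ e^{2 s₀ |g - E_ν g|} dν ≤ J`: for `0 < s ≤ s₀`,
`s |∫ g dμ - ∫ g dν| ≤ KL(μ‖ν) + s² (2J/s₀²)` (the easy half `∫ φ dμ ≤ KL + ∫ (e^φ - 1) dν`
at `φ = ±s(g - E_ν g)`, whose `ν`-mean vanishes, and `e^q - 1 - q ≤ (2s²/s₀²) e^{2 s₀|y|}`
at `q = ±s y`). [folklore] -/
theorem obl_dv_scale {α : Type*} [MeasurableSpace α] {μ ν : Measure α} [IsProbabilityMeasure μ]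
    [IsProbabilityMeasure ν] {g : α → ℝ} (hgm : Measurable g) (hgμ : Integrable g μ)
    (hgν : Integrable g ν) {s₀ J : ℝ} (hs₀ : 0 < s₀)
    (hexp : Integrable (fun x => Real.exp (2 * s₀ * |g x - ∫ y, g y ∂ν|)) ν)
    (hJ : ∫ x, Real.exp (2 * s₀ * |g x - ∫ y, g y ∂ν|) ∂ν ≤ J) (hfin : klDiv μ ν ≠ ∞)
    {s : ℝ} (hs : 0 < s) (hss : s ≤ s₀) :
    s * |∫ x, g x ∂μ - ∫ x, g x ∂ν| ≤ (klDiv μ ν).toReal + s ^ 2 * (2 * J / s₀ ^ 2) := by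
  obtain ⟨gbar, hgbar⟩ : ∃ gbar : ℝ, gbar = ∫ y, g y ∂ν := ⟨_, rfl⟩
  rw [← hgbar] at hexp hJ ⊢
  have one_side : ∀ σ : ℝ, (σ = 1 ∨ σ = -1) →
      σ * (s * (∫ x, g x ∂μ - gbar)) ≤ (klDiv μ ν).toReal + s ^ 2 * (2 * J / s₀ ^ 2) := by
    intro σ hσ
    have hσ1 : |σ| = 1 := by rcases hσ with rfl | rfl <;> simp
    have hφμ : Integrable (fun x => σ * (s * (g x - gbar))) μ :=
      ((hgμ.sub (integrable_const _)).const_mul s).const_mul σ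
    have hφν : Integrable (fun x => σ * (s * (g x - gbar))) ν :=
      ((hgν.sub (integrable_const _)).const_mul s).const_mul σ
    have hexpφ : Integrable (fun x => Real.exp (σ * (s * (g x - gbar)))) ν := by
      refine hexp.mono' (by fun_prop) (ae_of_all _ fun x => ?_)
      rw [Real.norm_eq_abs, abs_of_pos (Real.exp_pos _)]
      refine Real.exp_le_exp.2 ((le_abs_self _).trans ?_)
      rw [abs_mul, hσ1, one_mul, abs_mul, abs_of_pos hs]
      nlinarith [abs_nonneg (g x - gbar)]
    have hDV := Literature.Probability.Divergences.integral_le_toReal_klDiv_add_integral hfin hφμ hexpφ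
    have hintμ : ∫ x, σ * (s * (g x - gbar)) ∂μ = σ * (s * (∫ x, g x ∂μ - gbar)) := by
      rw [integral_const_mul, integral_const_mul, integral_sub hgμ (integrable_const _),
        integral_const, probReal_univ, one_smul]
    have hintν : ∫ x, σ * (s * (g x - gbar)) ∂ν = 0 := by
      rw [integral_const_mul, integral_const_mul, integral_sub hgν (integrable_const _),
        integral_const, probReal_univ, one_smul, hgbar, sub_self, mul_zero, mul_zero]
    have hI1 : Integrable (fun x => Real.exp (σ * (s * (g x - gbar))) - 1) ν :=
      hexpφ.sub (integrable_const _)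
    have heq : ∫ x, (Real.exp (σ * (s * (g x - gbar))) - 1) ∂ν =
        ∫ x, (Real.exp (σ * (s * (g x - gbar))) - 1 - σ * (s * (g x - gbar))) ∂ν := by
      rw [integral_sub hI1 hφν, hintν, sub_zero]
    have hrem : ∫ x, (Real.exp (σ * (s * (g x - gbar))) - 1) ∂ν ≤ s ^ 2 * (2 * J / s₀ ^ 2) := by
      rw [heq]
      calc ∫ x, (Real.exp (σ * (s * (g x - gbar))) - 1 - σ * (s * (g x - gbar))) ∂ν
          ≤ ∫ x, 2 * s ^ 2 / s₀ ^ 2 * Real.exp (2 * s₀ * |g x - gbar|) ∂ν := by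
            refine integral_mono (hI1.sub hφν) (hexp.const_mul _) fun x => ?_
            have h := obl_exp_remainder_le hs.le hss hs₀ (σ * (g x - gbar))
            rw [abs_mul, hσ1, one_mul] at h
            have e : σ * (s * (g x - gbar)) = s * (σ * (g x - gbar)) := by ring
            simpa only [e] using h
        _ = 2 * s ^ 2 / s₀ ^ 2 * ∫ x, Real.exp (2 * s₀ * |g x - gbar|) ∂ν :=
            integral_const_mul _ _
        _ ≤ 2 * s ^ 2 / s₀ ^ 2 * J := mul_le_mul_of_nonneg_left hJ (by positivity)
        _ = s ^ 2 * (2 * J / s₀ ^ 2) := by ring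
    linarith [hDV, hintμ]
  have h1 := one_side 1 (Or.inl rfl)
  have h2 := one_side (-1) (Or.inr rfl)
  have h3 : |s * (∫ x, g x ∂μ - gbar)| ≤ (klDiv μ ν).toReal + s ^ 2 * (2 * J / s₀ ^ 2) :=
    abs_le.2 ⟨by linarith, by linarith⟩
  rwa [abs_mul, abs_of_pos hs] at h3

/-- **Registered helper stub `stub_oneBodyLedger_of_static_kinetic`** (helper file of S2
`stub_oneBodyLedger_of_static`, line `local-gibbs-entropy-ledger`, crux
stmt-AtomisticToContinuum-14662): **the kinetic pairing is paid by the root entropy.** For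
`C ≥ 0`, `Θ ≥ 1` there is `L = L(C, Θ) > 0` such that for every continuous `g` with
`|g| ≤ C(1 + ‖v‖²)`, every COLD Maxwellian `N(u, θ id)` (`0 < θ ≤ Θ`, `‖u‖² ≤ Θ`) and every
probability `μ` with `∫ ‖v‖² dμ ≤ Θ` and `H = KL(μ ‖ N(u,θ)) < ∞`:
`|∫ g dμ - ∫ g dN(u,θ)| ≤ L √H`. Proof: Donsker–Varadhan at scale `s ≤ s₀ ~ 1/(C Θ)`
(`obl_dv_scale`; the exponential moment `∫ e^{2 s₀ |g - E_N g|} dN` is bounded by a Fernique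
constant of the standard Gaussian, uniformly over cold Maxwellians), then `s = √(H/κ)` if
`≤ s₀`, else the second-moment bound `|∫ g dμ - E_N g| ≤ C(2 + 9Θ) ≤ const · √H`
(`obl_optimize`). [folklore] -/
theorem stub_oneBodyLedger_of_static_kinetic :
    ∀ (C Θ : ℝ), 0 ≤ C → 1 ≤ Θ → ∃ L : ℝ, 0 < L ∧
      ∀ (g : V3 → ℝ), Continuous g → (∀ v, |g v| ≤ C * (1 + ‖v‖ ^ 2)) →
      ∀ (u : V3) (θ : ℝ), 0 < θ → θ ≤ Θ → ‖u‖ ^ 2 ≤ Θ →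
      ∀ (μ : Measure V3) [IsProbabilityMeasure μ], Integrable (fun v : V3 => ‖v‖ ^ 2) μ →
        ∫ v, ‖v‖ ^ 2 ∂μ ≤ Θ → klDiv μ (gaussMeasure u θ) ≠ ⊤ →
        |∫ v, g v ∂μ - ∫ v, g v ∂gaussMeasure u θ| ≤
          L * Real.sqrt (klDiv μ (gaussMeasure u θ)).toReal := by
  intro C Θ hC hΘ
  have hΘ0 : 0 < Θ := by linarith
  obtain ⟨c, hc, hci⟩ := obl_exists_exp_sq_integrable
  obtain ⟨I, hI⟩ : ∃ I : ℝ, I = ∫ w, Real.exp (c * ‖w‖ ^ 2) ∂stdGaussian V3 := ⟨_, rfl⟩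
  have hIpos : 0 < I := hI ▸ integral_exp_pos hci
  obtain ⟨A, hA⟩ : ∃ A : ℝ, A = C * (2 + 8 * Θ) := ⟨_, rfl⟩
  have hA0 : 0 ≤ A := by rw [hA]; positivity
  obtain ⟨s₀, hs₀pos, hs₀1, hs₀2⟩ := obl_scale c A Θ hc hA0 hΘ
  obtain ⟨J, hJ⟩ : ∃ J : ℝ, J = Real.exp c * (Real.exp c * I) := ⟨_, rfl⟩
  have hJpos : 0 < J := by rw [hJ]; positivity
  obtain ⟨κ, hκ⟩ : ∃ κ : ℝ, κ = 2 * J / s₀ ^ 2 := ⟨_, rfl⟩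
  have hκpos : 0 < κ := by rw [hκ]; positivity
  obtain ⟨D₀, hD₀⟩ : ∃ D₀ : ℝ, D₀ = C * (1 + Θ) + C * (1 + 8 * Θ) := ⟨_, rfl⟩
  have hD₀nn : 0 ≤ D₀ := by rw [hD₀]; positivity
  have hsqκ : 0 < Real.sqrt κ := Real.sqrt_pos.2 hκpos
  have hLpos : 0 < 2 * Real.sqrt κ + D₀ / (s₀ * Real.sqrt κ) + 1 := by positivity
  refine ⟨2 * Real.sqrt κ + D₀ / (s₀ * Real.sqrt κ) + 1, hLpos, ?_⟩
  intro g hg hgC u θ hθ hθΘ huΘ μ _ h2 h2Θ hfin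
  -- moments, the centring constant and the centred observable
  obtain ⟨hN2, hN2le⟩ := obl_norm_sq_gaussMeasure u hθ
  obtain ⟨hgN, hgbarle⟩ := obl_integrable_of_growth hN2 hg hgC
  obtain ⟨hgμ, hgμle⟩ := obl_integrable_of_growth h2 hg hgC
  obtain ⟨gbar, hgbar⟩ : ∃ gbar : ℝ, gbar = ∫ v, g v ∂gaussMeasure u θ := ⟨_, rfl⟩
  rw [← hgbar] at hgbarle
  have hgbarb : |gbar| ≤ C * (1 + 8 * Θ) := hgbarle.trans (by nlinarith)
  have hXD₀ : |∫ v, g v ∂μ - gbar| ≤ D₀ :=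
    (abs_sub _ _).trans (hD₀ ▸ add_le_add (hgμle.trans (by nlinarith)) hgbarb)
  have hG : ∀ v, |g v - gbar| ≤ A * (1 + ‖v‖ ^ 2) := fun v => by
    calc |g v - gbar| ≤ |g v| + |gbar| := abs_sub _ _
      _ ≤ C * (1 + ‖v‖ ^ 2) + C * (1 + 8 * Θ) := add_le_add (hgC v) hgbarb
      _ ≤ A * (1 + ‖v‖ ^ 2) := by
          rw [hA]
          nlinarith [mul_nonneg hC (sq_nonneg ‖v‖), mul_nonneg (mul_nonneg hC hΘ0.le) (sq_nonneg ‖v‖)]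
  -- the Gaussian exponential moment of the centred observable, uniformly on cold Maxwellians
  have ha : 2 * (2 * s₀ * A) * θ ≤ c := by
    nlinarith [mul_nonneg (mul_nonneg hs₀pos.le hA0) hθ.le, mul_nonneg (mul_nonneg hs₀pos.le hA0) (sub_nonneg.2 hθΘ)]
  obtain ⟨hΦi, hΦle⟩ :=
    obl_integrable_exp_sq_gaussMeasure hci (by positivity : 0 ≤ 2 * s₀ * A) hθ ha u
  rw [← hI] at hΦle
  have hexpG : ∀ v, Real.exp (2 * s₀ * |g v - gbar|) ≤
      Real.exp (2 * s₀ * A) * Real.exp (2 * s₀ * A * ‖v‖ ^ 2) := fun v => by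
    rw [← Real.exp_add]
    refine Real.exp_le_exp.2 ?_
    have := mul_le_mul_of_nonneg_left (hG v) (by positivity : 0 ≤ 2 * s₀)
    nlinarith
  have hdomi : Integrable (fun v : V3 =>
      Real.exp (2 * s₀ * A) * Real.exp (2 * s₀ * A * ‖v‖ ^ 2)) (gaussMeasure u θ) :=
    hΦi.const_mul _
  have hexpGi : Integrable (fun v : V3 => Real.exp (2 * s₀ * |g v - gbar|)) (gaussMeasure u θ) :=
    hdomi.mono' (by fun_prop : Continuous fun v : V3 =>
      Real.exp (2 * s₀ * |g v - gbar|)).aestronglyMeasurable (ae_of_all _ fun v => by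
        rw [Real.norm_eq_abs, abs_of_pos (Real.exp_pos _)]; exact hexpG v)
  have hJbound : ∫ v, Real.exp (2 * s₀ * |g v - gbar|) ∂gaussMeasure u θ ≤ J := by
    have h2u : 2 * (2 * s₀ * A) * ‖u‖ ^ 2 ≤ c := by
      nlinarith [mul_nonneg (mul_nonneg hs₀pos.le hA0) (sq_nonneg ‖u‖),
        mul_nonneg (mul_nonneg hs₀pos.le hA0) (sub_nonneg.2 huΘ)]
    calc ∫ v, Real.exp (2 * s₀ * |g v - gbar|) ∂gaussMeasure u θ
        ≤ ∫ v, Real.exp (2 * s₀ * A) * Real.exp (2 * s₀ * A * ‖v‖ ^ 2) ∂gaussMeasure u θ :=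
          integral_mono hexpGi hdomi hexpG
      _ = Real.exp (2 * s₀ * A) * ∫ v, Real.exp (2 * s₀ * A * ‖v‖ ^ 2) ∂gaussMeasure u θ :=
          integral_const_mul _ _
      _ ≤ Real.exp c * (Real.exp c * I) := by
          refine mul_le_mul (Real.exp_le_exp.2 hs₀1) (hΦle.trans ?_) (by positivity) (by positivity)
          exact mul_le_mul_of_nonneg_right (Real.exp_le_exp.2 h2u) hIpos.le
      _ = J := hJ.symm
  -- Donsker–Varadhan at every admissible scale, then optimisation in the scale
  rw [hgbar] at hexpGi hJbound
  have key : ∀ s : ℝ, 0 < s → s ≤ s₀ →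
      s * |∫ v, g v ∂μ - ∫ v, g v ∂gaussMeasure u θ| ≤
        (klDiv μ (gaussMeasure u θ)).toReal + s ^ 2 * κ := fun s hs hss => by
    rw [hκ]
    exact obl_dv_scale hg.measurable hgμ hgN hs₀pos hexpGi hJbound hfin hs hss
  rw [hgbar] at hXD₀
  by_cases hh : (klDiv μ (gaussMeasure u θ)).toReal = 0
  · have hH0 : klDiv μ (gaussMeasure u θ) = 0 :=
      ((ENNReal.toReal_eq_zero_iff _).1 hh).resolve_right hfin
    have hμN : μ = gaussMeasure u θ := klDiv_eq_zero_iff.1 hH0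
    have hX0 : ∫ v, g v ∂μ - ∫ v, g v ∂gaussMeasure u θ = 0 := by rw [← hμN, sub_self]
    rw [hX0, hh, abs_zero, Real.sqrt_zero, mul_zero]
  · have hpos : 0 < (klDiv μ (gaussMeasure u θ)).toReal :=
      lt_of_le_of_ne ENNReal.toReal_nonneg (Ne.symm hh)
    have ha' : 0 < Real.sqrt (klDiv μ (gaussMeasure u θ)).toReal := Real.sqrt_pos.2 hpos
    have key' : ∀ s : ℝ, 0 < s → s ≤ s₀ →
        s * |∫ v, g v ∂μ - ∫ v, g v ∂gaussMeasure u θ| ≤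
          Real.sqrt (klDiv μ (gaussMeasure u θ)).toReal ^ 2 + s ^ 2 * Real.sqrt κ ^ 2 :=
      fun s hs hss => by
        rw [Real.sq_sqrt hpos.le, Real.sq_sqrt hκpos.le]; exact key s hs hss
    calc |∫ v, g v ∂μ - ∫ v, g v ∂gaussMeasure u θ|
        ≤ (2 * Real.sqrt κ + D₀ / (s₀ * Real.sqrt κ)) * Real.sqrt (klDiv μ (gaussMeasure u θ)).toReal :=
          obl_optimize (abs_nonneg _) hXD₀ ha' hsqκ hs₀pos key'
      _ ≤ (2 * Real.sqrt κ + D₀ / (s₀ * Real.sqrt κ) + 1) *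
            Real.sqrt (klDiv μ (gaussMeasure u θ)).toReal :=
          mul_le_mul_of_nonneg_right (by linarith) ha'.le

end Summit.AtomisticToContinuum.HydrodynamicLimit.Theorems.KineticCurrentsWindowLDUniformLocalGibbs

end
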